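import Mathlib

/-!
# `ConfusionCovering` (crux dir `OrbitDimensionBound`, stmt-ValiantsHypothesis-16133, route FreeSubtorus):
# the FLOW LEMMA — acyclic unit flows are paths

Tool file for the proof of the rung `ConfusionCovering` (line `confusion_covering`, stub `stub_pathWeights`).

Combinatorial heart of the subtorus path-weights theorem.  Edges `k ∈ E` go from `src k` to `dst k = c k · src k`
in `ℂˣ`; no product of a non-empty sequence of the `c k` is `1` (no directed cycles).  If every vertex `w ≠ γ₀` has
at least as many incoming as outgoing edges, and `γ₀` has at most one more outgoing than incoming, then the edges form
ONE directed path starting at `γ₀` (`exists_chain_of_flow`): for every `1 ≤ i ≤ |E|` there is an `i`-subset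
`I ⊆ E` and an edge `k ∈ I` ending at `γ₀ · ∏_{k' ∈ I} c k'`.  Source edges exist because an edge-to-predecessor map
on a finite set would have a periodic orbit, i.e. a cycle (`exists_source_edge`). [folklore]
-/

open Finset

-- the mandated summit-side namespace repeats a component by design (single-problem summit)
set_option linter.dupNamespace false

namespace Summit.ValiantsHypothesis.ValiantsHypothesis.Theorems.FreeSubtorusConfusionCovering

noncomputable section

variable {κ : Type*}

/-- **A source edge exists.**  If `dst k = c k · src k` with `c k, src k ≠ 0` on `E ≠ ∅` and no product of a
non-empty sequence of the `c`'s over `E` is `1`, then some edge `k₀ ∈ E` has its source hit by no edge: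
`dst k ≠ src k₀` for all `k ∈ E`.  (Otherwise an edge-to-predecessor map `f` on `E` has a periodic orbit
`y, f y, …, f^{t-1} y`; the product of `dst` over the orbit equals the product of `src`, forcing `∏ c = 1`.) [folklore] -/
theorem exists_source_edge (c src dst : κ → ℂ) (E : Finset κ) (hE : E.Nonempty)
    (hc0 : ∀ k ∈ E, c k ≠ 0) (hdst : ∀ k ∈ E, dst k = c k * src k) (hsrc : ∀ k ∈ E, src k ≠ 0)
    (hseq : ∀ (t : ℕ) (p : ℕ → κ), 0 < t → (∀ s, s < t → p s ∈ E) → ∏ s ∈ range t, c (p s) ≠ 1) :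
    ∃ k₀ ∈ E, ∀ k ∈ E, dst k ≠ src k₀ := by
  classical
  by_contra hall
  push Not at hall
  -- an edge-to-predecessor map on `E`
  have hpred : ∀ x : E, ∃ y : E, dst (y : κ) = src (x : κ) := fun x => by
    obtain ⟨k, hk, hkx⟩ := hall x.1 x.2
    exact ⟨⟨k, hk⟩, hkx⟩
  choose f hf using hpred
  obtain ⟨x₀, hx₀⟩ := hE
  -- a periodic point
  obtain ⟨i, j, hij, hfij⟩ := Finite.exists_ne_map_eq_of_infinite fun s : ℕ => f^[s] ⟨x₀, hx₀⟩
  wlog hlt : i < j generalizing i j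
  · exact this j i hij.symm hfij.symm (lt_of_le_of_ne (not_lt.1 hlt) hij.symm)
  obtain ⟨t, rfl⟩ : ∃ t, j = i + t := ⟨j - i, by omega⟩
  have ht : 0 < t := by omega
  set y : E := f^[i] ⟨x₀, hx₀⟩ with hy
  have hper : f^[t] y = y := by
    rw [hy, ← Function.iterate_add_apply, add_comm]; exact hfij.symm
  -- products over the orbit: `∏ dst = ∏ src`
  set g : ℕ → ℂ := fun s => dst ((f^[s] y : E) : κ) with hg
  have hmem : ∀ s, ((f^[s] y : E) : κ) ∈ E := fun s => (f^[s] y).2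
  have h0 : g 0 ≠ 0 := by
    simp only [hg, Function.iterate_zero, id_eq]
    rw [hdst _ y.2]
    exact mul_ne_zero (hc0 _ y.2) (hsrc _ y.2)
  have hshift : ∏ s ∈ range t, g (s + 1) = ∏ s ∈ range t, g s := by
    have h1 := Finset.prod_range_succ' g t
    have h2 := Finset.prod_range_succ g t
    have hgt : g t = g 0 := by simp only [hg, hper, Function.iterate_zero, id_eq]
    rw [hgt] at h2
    exact mul_right_cancel₀ h0 (h1.symm.trans h2)
  have hsrc_eq : ∏ s ∈ range t, src ((f^[s] y : E) : κ) = ∏ s ∈ range t, g s := by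
    rw [← hshift]
    refine Finset.prod_congr rfl fun s _ => ?_
    simp only [hg, Function.iterate_succ_apply', hf]
  have hdst_eq : ∏ s ∈ range t, g s =
      (∏ s ∈ range t, c ((f^[s] y : E) : κ)) * ∏ s ∈ range t, src ((f^[s] y : E) : κ) := by
    rw [← prod_mul_distrib]
    exact Finset.prod_congr rfl fun s _ => hdst _ (hmem s)
  have hne : ∏ s ∈ range t, src ((f^[s] y : E) : κ) ≠ 0 :=
    Finset.prod_ne_zero_iff.2 fun s _ => hsrc _ (hmem s)
  have hone : ∏ s ∈ range t, c ((f^[s] y : E) : κ) = 1 := by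
    have := hsrc_eq.trans hdst_eq
    exact (mul_eq_right₀ hne).1 this.symm
  exact hseq t (fun s => ((f^[s] y : E) : κ)) ht (fun s _ => hmem s) hone

/-- **The flow lemma.**  Edges `k ∈ E` with `dst k = c k · src k` (`c k, src k ≠ 0`), no product of a non-empty
sequence of `c`'s over `E` equal to `1`; if `#{k | src k = w} ≤ #{k | dst k = w}` for every `w ≠ γ₀` and
`#{k | src k = γ₀} ≤ #{k | dst k = γ₀} + 1`, then for every `1 ≤ i ≤ |E|` some `i`-subset `I ⊆ E` contains an edge
ending at `γ₀ · ∏_{k' ∈ I} c k'` (the edges form one path from `γ₀`; peel its first edge and induct). [folklore] -/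
theorem exists_chain_of_flow [DecidableEq κ] (c src dst : κ → ℂ)
    (hseq : ∀ (t : ℕ) (p : ℕ → κ), 0 < t → ∏ s ∈ range t, c (p s) ≠ 1) :
    ∀ (N : ℕ) (E : Finset κ) (γ₀ : ℂ), E.card = N →
      (∀ k ∈ E, c k ≠ 0) → (∀ k ∈ E, dst k = c k * src k) → (∀ k ∈ E, src k ≠ 0) →
      (∀ w, w ≠ γ₀ → (E.filter fun k => src k = w).card ≤ (E.filter fun k => dst k = w).card) →
      (E.filter fun k => src k = γ₀).card ≤ (E.filter fun k => dst k = γ₀).card + 1 →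
      ∀ i, 1 ≤ i → i ≤ N → ∃ I : Finset κ, I ⊆ E ∧ I.card = i ∧ ∃ k ∈ I, dst k = γ₀ * ∏ k' ∈ I, c k' := by
  classical
  intro N
  induction N with
  | zero => intro E γ₀ _ _ _ _ _ _ i hi1 hi0; omega
  | succ N ih =>
    intro E γ₀ hcard hc0 hdst hsrc hA hA' i hi1 hiN
    have hE : E.Nonempty := by rw [← Finset.card_pos, hcard]; exact Nat.succ_pos _
    -- the first edge of the path
    obtain ⟨k₀, hk₀, hsource⟩ := exists_source_edge c src dst E hE hc0 hdst hsrc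
      (fun t p ht _ => hseq t p ht)
    have hk₀src : src k₀ = γ₀ := by
      by_contra hne
      have h1 := hA (src k₀) hne
      have h2 : (E.filter fun k => dst k = src k₀) = ∅ :=
        Finset.filter_eq_empty_iff.2 fun k hk => hsource k hk
      rw [h2, card_empty, Nat.le_zero, Finset.card_eq_zero, Finset.filter_eq_empty_iff] at h1
      exact h1 hk₀ rfl
    have hγ₀0 : γ₀ ≠ 0 := hk₀src ▸ hsrc k₀ hk₀
    have hk₀dst : dst k₀ = c k₀ * γ₀ := by rw [hdst k₀ hk₀, hk₀src]
    have hγne : c k₀ * γ₀ ≠ γ₀ := by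
      intro h
      have : c k₀ = 1 := (mul_eq_right₀ hγ₀0).1 h
      exact hseq 1 (fun _ => k₀) one_pos (by simpa using this)
    rcases Nat.lt_or_ge 1 i with hi2 | hi2
    · -- peel `k₀` and induct on `E.erase k₀` from `γ₀' = c k₀ · γ₀`
      set E' := E.erase k₀ with hE'
      have hcard' : E'.card = N := by rw [hE', Finset.card_erase_of_mem hk₀, hcard]; rfl
      have hsub : E' ⊆ E := Finset.erase_subset _ _
      have hB : ∀ w, w ≠ c k₀ * γ₀ →
          (E'.filter fun k => src k = w).card ≤ (E'.filter fun k => dst k = w).card := by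
        intro w hw
        have hR : (E'.filter fun k => dst k = w) = E.filter fun k => dst k = w := by
          rw [hE', Finset.filter_erase, Finset.erase_eq_of_notMem]
          intro hmem
          exact hw ((mem_filter.1 hmem).2.symm.trans hk₀dst)
        rw [hR, hE', Finset.filter_erase]
        by_cases hwγ : w = γ₀
        · subst hwγ
          have hmem : k₀ ∈ E.filter fun k => src k = src k₀ := mem_filter.2 ⟨hk₀, rfl⟩
          rw [hk₀src] at hmem
          rw [Finset.card_erase_of_mem hmem]
          have := hA'
          omega
        · exact (card_le_card (erase_subset _ _)).trans (hA w hwγ)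
      have hB' : (E'.filter fun k => src k = c k₀ * γ₀).card ≤
          (E'.filter fun k => dst k = c k₀ * γ₀).card + 1 := by
        have hL : (E'.filter fun k => src k = c k₀ * γ₀) = E.filter fun k => src k = c k₀ * γ₀ := by
          rw [hE', Finset.filter_erase, Finset.erase_eq_of_notMem]
          intro hmem
          exact hγne ((mem_filter.1 hmem).2.symm.trans hk₀src)
        have hmem : k₀ ∈ E.filter fun k => dst k = c k₀ * γ₀ := mem_filter.2 ⟨hk₀, hk₀dst⟩
        have hR : (E'.filter fun k => dst k = c k₀ * γ₀).card + 1 = (E.filter fun k => dst k = c k₀ * γ₀).card := by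
          rw [hE', Finset.filter_erase, Finset.card_erase_of_mem hmem]
          have := Finset.card_pos.2 ⟨k₀, hmem⟩
          omega
        rw [hL, hR]
        exact hA _ hγne
      obtain ⟨I', hI'E, hI'card, k, hkI', hk⟩ := ih E' (c k₀ * γ₀) hcard' (fun k hk => hc0 k (hsub hk))
        (fun k hk => hdst k (hsub hk)) (fun k hk => hsrc k (hsub hk)) hB hB' (i - 1) (by omega) (by omega)
      have hk₀I' : k₀ ∉ I' := fun h => Finset.notMem_erase k₀ E (hI'E h)
      refine ⟨insert k₀ I', Finset.insert_subset hk₀ (hI'E.trans hsub), ?_, k, mem_insert_of_mem hkI', ?_⟩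
      · rw [card_insert_of_notMem hk₀I', hI'card]; omega
      · rw [hk, prod_insert hk₀I']; ring
    · -- `i = 1`: the first edge itself
      have hi : i = 1 := le_antisymm hi2 hi1
      subst hi
      refine ⟨{k₀}, Finset.singleton_subset_iff.2 hk₀, card_singleton _, k₀, mem_singleton_self _, ?_⟩
      rw [prod_singleton, hk₀dst, mul_comm]

end

end Summit.ValiantsHypothesis.ValiantsHypothesis.Theorems.FreeSubtorusConfusionCovering
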